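/-
Copyright (c) 2026 the pub-hodgecm-mathlib formalisation cell (harness21).  Prover seat hodgecm-mathlib-LH4-p04 (g7), req620 Track A «(D-RAM) FOUR-FRAME» squad
(STAGE-1b; dealer∕pen LH4-plan (g13) WORD #84 «(κ₂) the kernel–Cayley–Hamilton letter's payer»; letter = LH4-p14 (g6) `kappa2.letter.v1` de8a864c8493cebb), 2026-09-04.
-/
import Summits.HodgeConjecture.HodgeConjecture.Theorems.F0P3cDyRamLevelsTypeTwoLiterals         -- ★ p859549 (this seat): brings ★ p859496 (signed pair), ★ p857702 `exists_oppositeLiteral_wild`, ★ frame literal, ★ Prelude, ★ p856218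
import Summits.HodgeConjecture.HodgeConjecture.Theorems.F0P3cDyRamTypeTwoBlockCongruenceNhds      -- ★ (LH4-p11 (g5)): `exists_nhds_one_block_congr` (the w-block of `γ_H` is `≡ 1 (mod c)` near `1`)
import Summits.HodgeConjecture.HodgeConjecture.Theorems.F0P3cDyRamStageOneBDefs                  -- ★ №5 `mcOfRecord`
import Literature.NumberTheory.Automorphic.UnitaryLatticeTreeBlockGlueLevel                      -- ★ (E1) (LH4-p07 (g8)): block-at-1 algebra, `mulVec_of_row_one_of_apply_one_eq_zero`, `compress_endoGL_sub_one(_sq)`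
import Literature.NumberTheory.Rogawski1990.DepthZeroKappaTransferTypeTwoRamifiedSpectralTieResidual  -- ★ `SpectralTie.trace_eq_of_charpoly_eq` ∕ `det_eq_of_charpoly_eq` (2 × 2 charpoly coefficients; reused, not restated)
import Summits.HodgeConjecture.HodgeConjecture.Theorems.F0P3cDyRamTypeTwoTubeLetters              -- ★ `v_trace_sub_two_le` (entrywise congruence ⇒ trace bound; reused, not restated)
import HarnessLib

/-!
# Crux `H413`, line LH4 «(D-RAM) FOUR-FRAME» — STAGE-1b, row (2): (κ₂) «THE KERNEL–CAYLEY–HAMILTON LETTER OF A TYPE-(2) NORM MATCH», PAID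
# near `1`, for every norm match `δ` of a non-split `γ_H`: on the `δ`-plane `ker π`, `X = ι_w(δ) − 1` satisfies `X² = s·X − p` with `|s|, |p| ≤ |ϖ^{m_c}|`

Cell `hodgecm-mathlib` (D-0151), FLOOR 0, crux item H413 = `stmt-HodgeConjecture-24833`, route of record `HCCMUnconditional`; squad F0∕P3c∕LH4; lane
`--supports stmt-HodgeConjecture-24833 --as helper` (count-neutral; pays NO tier-0 row).  THEOREMS ONLY (no `def`, no instance, no notation, no `sorry`).
THE LETTER (LH4-p14 (g6) `kappa2.letter.v1` de8a864c, the `hKer` binder of ★-cand `labelPlusClean_typeTwo_of_kerCH`; ∀-closed over the f2316d92 place prefix):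
`∃ V ∈ 𝓝 1, ∀ γ_H ∈ V, G-regular, w-block charpoly rootless → ∀ δ, IsLocalNormPair γ_H δ → ∃ (π : L_w³ →ₗ L_w) (s p : L_w), (∀ m, π m = 0 → X(X m) = s•X m − p•m) ∧
|s|·|ϖ^{d%2}| ≤ |ϖ^{m_c d}| ∧ |p| ≤ |ϖ^{m_c d}|`, `X = ι_w(δ) − 1`.  PAY CHAIN (dealer WORD #84): `α₂ := labelPlusClean_typeTwo_of_kerCH hKer_ofRecord`.
THE PROOF (no eigenline, no frame decomposition over `L_w`, no lattice):
* §1 BLOCK ALGEBRA (any field): if `T = Q·ι(A, u)·Q⁻¹` then on `ker (m ↦ (Q⁻¹m)₁)` — the image of the plane `W` under `Q` — `T − 1` acts through the COMPRESSION `A − 1` (★ (E1)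
  `mulVec_of_row_one_of_apply_one_eq_zero` ∕ `compress_endoGL_sub_one(_sq)`), and 2 × 2 Cayley–Hamilton `(A − 1)² = tr(A − 1)·(A − 1) − det(A − 1)·1` gives
  `X(Xm) = (tr A − 2)•Xm − (det A − tr A + 1)•m` (`kerCH_of_eq_conj_endoGL`); `tr`, `det` are charpoly coefficients (★ `SpectralTie.trace_eq_of_charpoly_eq` ∕ `det_eq_of_charpoly_eq`).
* §2 VALUATION: `|(g − 1)_{ij}| ≤ |c| ≤ 1` entrywise ⇒ `|tr g − 2| ≤ |c|` (★ `…TypeTwoTubeLetters.v_trace_sub_two_le`), `|det g − tr g + 1| ≤ |c|` (ultrametric).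
* §3 HEAD `hKer_ofRecord`: `V :=` ★ `exists_nhds_one_block_congr (c := ϖ^{m_c d})` ∩ ★ p857702's; a norm match `δ` has `κ = ±1` (★ `finKappaAt_eq_one_or_eq_neg_one_of_isUnit`), so by
  the signed pair's exhaustion (★ p847309 road, as in ★ p859496 §3) it is `G_v`-CONJUGATE to the hyperbolic literal `t_h` (`ι t_h = ι(g_w, u_w)`, ★ frame literal at `A := 1`) or to the
  anisotropic one `t_a` (`ι t_a = P₁·ι(γ₁, u_w)·P₁⁻¹`, `χ_{γ₁} = χ_{g_w}`, ★ p857702); either way `ι_w δ = Q·ι(A, u_w)·Q⁻¹` with `χ_A = χ_{g_w}`, so §1 applies with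
  `s = tr g_w − 2`, `p = det g_w − tr g_w + 1` (δ-FREE), and §2 with ★ block congruence bounds them by `|ϖ^{m_c d}|`.
HONEST LABEL.  Count-neutral; nothing printed is asserted beyond this linear algebra; α₂∕β₂ remain HYPOTHESES of the T₊ chain until their payers are ★; `HC_CM` is proved only modulo the
7 printed citations (2 remaining named inputs: hLiu418 = `stmt-HodgeConjecture-24832`, h413 = `stmt-HodgeConjecture-24833`) until rung 0 closes.
## References
* [Rogawski1990] J. D. Rogawski, *Automorphic Representations of Unitary Groups in Three Variables*, Ann. of Math. Stud. 123 (1990): §4.3 (4.3.1)–(4.3.2) p. 43; §4.8 Case (a) p. 53; §4.9 Prop. 4.9.1 (b) p. 55.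
* [BernsteinZelevinsky1976] I. N. Bernstein, A. V. Zelevinsky, *Representations of GL(n, F)*, Russian Math. Surveys 31 (1976): §1.1 (congruence neighbourhoods).
* [Jacobowitz1962] R. Jacobowitz, *Hermitian forms over local fields*, Amer. J. Math. 84 (1962): §7 Thm. 7.1.
-/

set_option autoImplicit false

noncomputable section
namespace Summit.HodgeConjecture.HodgeConjecture.Cruxes.H413.F0P3cDyRamKernelCHOfTypeTwo

open MeasureTheory Measure NumberField IsDedekindDomain Topology Filter
open Literature.NumberTheory.Automorphic Literature.NumberTheory.Automorphic.UnitaryGroup Literature.NumberTheory.Automorphic.IntegralReduction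
open Literature.NumberTheory.Rogawski1990 Literature.NumberTheory.GaloisRepresentations
open Literature.NumberTheory.Automorphic.UnitaryThreeFourFrame
open Literature.NumberTheory.Automorphic.UnitaryLatticeTree Literature.NumberTheory.Automorphic.HermitianLattice
open Literature.NumberTheory.QuadraticForms
open Summit.HodgeConjecture.HodgeConjecture.Cruxes.H413.F0P3cDyRamFourFrameHSideDefs
open Summit.HodgeConjecture.HodgeConjecture.Cruxes.H413.F0P3cDyRamFourFramePieces
open Summit.HodgeConjecture.HodgeConjecture.Cruxes.H413.F0P3cDyRamStageOneBDefs
open Summit.HodgeConjecture.HodgeConjecture.Cruxes.H413.F0P3cDyRamLevelsTypeTwoDictionary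
open Summit.HodgeConjecture.HodgeConjecture.Cruxes.H413.F0P3cDyRamProfilePiecesProps (uniformizer_facts)
open Summit.HodgeConjecture.HodgeConjecture.Cruxes.H413
open scoped Matrix MatrixGroups Classical Valued WithZero

/-! ## §1 Block algebra: Cayley–Hamilton on the conjugated plane -/

section Algebra

variable {K : Type*} [Field K]

/-- 2 × 2 Cayley–Hamilton at `1`: `(A − 1)·(A − 1) = (tr A − 2)•(A − 1) − (det A − tr A + 1)•1`. [cite: Rogawski1990, §4.3 p. 43] -/
theorem sub_one_mul_sub_one_fin_two (A : Matrix (Fin 2) (Fin 2) K) :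
    (A - 1) * (A - 1) = (A.trace - 2) • (A - 1) - (A.det - A.trace + 1) • (1 : Matrix (Fin 2) (Fin 2) K) := by
  ext i j
  fin_cases i <;> fin_cases j <;>
    simp [Matrix.mul_apply, Fin.sum_univ_two, Matrix.det_fin_two, Matrix.trace_fin_two, Matrix.one_apply] <;> ring

/-- `ι_W(s•x − p•y) = s•ι_W x − p•ι_W y` (coordinates `(·, 0, ·)`). -/
theorem plane_smul_sub_smul (s p : K) (x y : Fin 2 → K) :
    (![(s • x - p • y) 0, 0, (s • x - p • y) 1] : Fin 3 → K) = s • (![x 0, 0, x 1] : Fin 3 → K) - p • (![y 0, 0, y 1] : Fin 3 → K) := by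
  ext i; fin_cases i <;> simp

/-- **KERNEL–CAYLEY–HAMILTON FOR A CONJUGATE OF A BLOCK ELEMENT.**  If `T = Q·ι(A, u)·Q⁻¹` in `GL₃`, then for every `m` with `(Q⁻¹ m)₁ = 0` (i.e. `m ∈ Q·W`):
`(T − 1)((T − 1)m) = (tr A − 2)•(T − 1)m − (det A − tr A + 1)•m` — on `Q·W` the operator `T − 1` is the compression `A − 1` (★ (E1)), and `A − 1` satisfies its characteristic
polynomial. [cite: Rogawski1990, §4.8 Case (a) p. 53; §4.3 p. 43] -/
theorem kerCH_of_eq_conj_endoGL (Q : GL (Fin 3) K) (A : GL (Fin 2) K) (u : GL (Fin 1) K) {T : Matrix (Fin 3) (Fin 3) K}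
    (hT : T = (Q : Matrix (Fin 3) (Fin 3) K) * ((endoGL (A, u) : GL (Fin 3) K) : Matrix (Fin 3) (Fin 3) K) * ((Q⁻¹ : GL (Fin 3) K) : Matrix (Fin 3) (Fin 3) K))
    (m : Fin 3 → K) (hm : (((Q⁻¹ : GL (Fin 3) K) : Matrix (Fin 3) (Fin 3) K) *ᵥ m) 1 = 0) :
    (T - 1) *ᵥ ((T - 1) *ᵥ m) = ((A : Matrix (Fin 2) (Fin 2) K).trace - 2) • ((T - 1) *ᵥ m) -
      ((A : Matrix (Fin 2) (Fin 2) K).det - (A : Matrix (Fin 2) (Fin 2) K).trace + 1) • m := by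
  set E : Matrix (Fin 3) (Fin 3) K := ((endoGL (A, u) : GL (Fin 3) K) : Matrix (Fin 3) (Fin 3) K) with hE
  set w : Fin 3 → K := ((Q⁻¹ : GL (Fin 3) K) : Matrix (Fin 3) (Fin 3) K) *ᵥ m with hw
  have hQQ : (Q : Matrix (Fin 3) (Fin 3) K) * ((Q⁻¹ : GL (Fin 3) K) : Matrix (Fin 3) (Fin 3) K) = 1 := by
    rw [← Units.val_mul, mul_inv_cancel, Units.val_one]
  have hQQ' : ((Q⁻¹ : GL (Fin 3) K) : Matrix (Fin 3) (Fin 3) K) * (Q : Matrix (Fin 3) (Fin 3) K) = 1 := by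
    rw [← Units.val_mul, inv_mul_cancel, Units.val_one]
  have hmw : m = (Q : Matrix (Fin 3) (Fin 3) K) *ᵥ w := by
    rw [hw, Matrix.mulVec_mulVec, hQQ, Matrix.one_mulVec]
  -- `T − 1 = Q (E − 1) Q⁻¹`, so `(T − 1)(Q w') = Q((E − 1)w')`
  have hconj : ∀ w' : Fin 3 → K, (T - 1) *ᵥ ((Q : Matrix (Fin 3) (Fin 3) K) *ᵥ w') = (Q : Matrix (Fin 3) (Fin 3) K) *ᵥ ((E - 1) *ᵥ w') := by
    intro w'
    have hT1 : T - 1 = (Q : Matrix (Fin 3) (Fin 3) K) * (E - 1) * ((Q⁻¹ : GL (Fin 3) K) : Matrix (Fin 3) (Fin 3) K) := by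
      rw [hT, Matrix.mul_sub, Matrix.sub_mul, Matrix.mul_one, hQQ]
    rw [hT1, Matrix.mulVec_mulVec, Matrix.mul_assoc, Matrix.mul_assoc, hQQ', Matrix.mul_one, ← Matrix.mulVec_mulVec]
  -- on `W` the block element acts through its compression `A − 1`
  have hw1 : w 1 = 0 := hm
  have hrow : ∀ l : Fin 3, l ≠ 1 → (E - 1) 1 l = 0 := fun l hl => by rw [hE]; exact endoGL_sub_one_row A u l hl
  have hcomp : (!![(E - 1) 0 0, (E - 1) 0 2; (E - 1) 2 0, (E - 1) 2 2] : Matrix (Fin 2) (Fin 2) K) = (A : Matrix (Fin 2) (Fin 2) K) - 1 := by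
    rw [hE]; exact compress_endoGL_sub_one A u
  have hEpl : ∀ y : Fin 2 → K, (E - 1) *ᵥ (![y 0, 0, y 1] : Fin 3 → K) =
      (![(((A : Matrix (Fin 2) (Fin 2) K) - 1) *ᵥ y) 0, 0, (((A : Matrix (Fin 2) (Fin 2) K) - 1) *ᵥ y) 1] : Fin 3 → K) := fun y => by
    rw [mulVec_plane_of_row_one hrow, hcomp]
  have hwp : w = (![(![w 0, w 2] : Fin 2 → K) 0, 0, (![w 0, w 2] : Fin 2 → K) 1] : Fin 3 → K) := by
    conv_lhs => rw [eq_plane_of_apply_one_eq_zero hw1]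
    simp
  set y : Fin 2 → K := ![w 0, w 2] with hy
  set x : Fin 2 → K := ((A : Matrix (Fin 2) (Fin 2) K) - 1) *ᵥ y with hx
  have hXm : (T - 1) *ᵥ m = (Q : Matrix (Fin 3) (Fin 3) K) *ᵥ (![x 0, 0, x 1] : Fin 3 → K) := by
    rw [hmw, hconj, hwp, hEpl]
  have hXXm : (T - 1) *ᵥ ((T - 1) *ᵥ m) =
      (Q : Matrix (Fin 3) (Fin 3) K) *ᵥ (![((((A : Matrix (Fin 2) (Fin 2) K) - 1) *ᵥ x) 0), 0, ((((A : Matrix (Fin 2) (Fin 2) K) - 1) *ᵥ x) 1)] : Fin 3 → K) := by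
    rw [hXm, hconj, hEpl]
  -- Cayley–Hamilton on the plane vector
  have hCH : ((A : Matrix (Fin 2) (Fin 2) K) - 1) *ᵥ x =
      ((A : Matrix (Fin 2) (Fin 2) K).trace - 2) • x - ((A : Matrix (Fin 2) (Fin 2) K).det - (A : Matrix (Fin 2) (Fin 2) K).trace + 1) • y := by
    rw [hx, Matrix.mulVec_mulVec, sub_one_mul_sub_one_fin_two, Matrix.sub_mulVec, Matrix.smul_mulVec, Matrix.smul_mulVec, Matrix.one_mulVec]
  rw [hXXm, hCH, plane_smul_sub_smul, Matrix.mulVec_sub, Matrix.mulVec_smul, Matrix.mulVec_smul, ← hXm, ← hwp, ← hmw]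

end Algebra

/-! ## §2 Valuation: entrywise congruence of a 2 × 2 block bounds the two Cayley–Hamilton coefficients -/

section Valuation

variable {K : Type*} [Field K] [Valued K ℤᵐ⁰]

/-- `|(g − 1)_{ij}| ≤ |c| ≤ 1` entrywise ⇒ `|det g − tr g + 1| = |det (g − 1)| ≤ |c|`. [cite: BernsteinZelevinsky1976, §1.1] -/
theorem v_det_sub_trace_add_one_le {g : Matrix (Fin 2) (Fin 2) K} {c : K} (hc : Valued.v c ≤ 1)
    (h : ∀ i j, Valued.v (g i j - (1 : Matrix (Fin 2) (Fin 2) K) i j) ≤ Valued.v c) :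
    Valued.v (g.det - g.trace + 1) ≤ Valued.v c := by
  have e : g.det - g.trace + 1 = (g 0 0 - (1 : Matrix (Fin 2) (Fin 2) K) 0 0) * (g 1 1 - (1 : Matrix (Fin 2) (Fin 2) K) 1 1) -
      (g 0 1 - (1 : Matrix (Fin 2) (Fin 2) K) 0 1) * (g 1 0 - (1 : Matrix (Fin 2) (Fin 2) K) 1 0) := by
    rw [Matrix.det_fin_two, Matrix.trace_fin_two]; simp; ring
  rw [e]
  have hcc : Valued.v c * Valued.v c ≤ Valued.v c := by
    calc Valued.v c * Valued.v c ≤ Valued.v c * 1 := mul_le_mul' le_rfl hc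
      _ = Valued.v c := mul_one _
  refine Valuation.map_sub_le _ ?_ ?_
  · rw [map_mul]; exact (mul_le_mul' (h 0 0) (h 1 1)).trans hcc
  · rw [map_mul]; exact (mul_le_mul' (h 0 1) (h 1 0)).trans hcc

end Valuation

/-! ## §3 HEAD — the (κ₂) letter, paid -/

set_option maxHeartbeats 400000 in
/-- **(κ₂) THE KERNEL–CAYLEY–HAMILTON LETTER OF A TYPE-(2) NORM MATCH** — LH4-p14 (g6)'s `kappa2.letter.v1` (de8a864c8493cebb) VERBATIM: near `1 ∈ H_v`, for every `G`-regular `γ_H`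
whose w-block has no eigenvalue in `L_w` and every norm match `δ`, there are a functional `π` (cutting out `δ`'s invariant plane) and δ-free scalars `s = tr g_w − 2`, `p = det g_w − tr g_w + 1`
(`g_w` the w-block of `γ_H`) with `X(Xm) = s•Xm − p•m` on `ker π`, `X = ι_w δ − 1`, and `|s|·|ϖ^{d%2}| ≤ |ϖ^{m_c}|`, `|p| ≤ |ϖ^{m_c}|`.  §1 ∘ §2 over the signed-pair exhaustion and the two
★ literal shapes (§3 of the module doc). [cite: Rogawski1990, §4.3 (4.3.1)–(4.3.2) p. 43; §4.8 Case (a) p. 53; §4.9 Prop. 4.9.1 (b) p. 55] [cite: BernsteinZelevinsky1976, §1.1] [cite: Jacobowitz1962, §7 Thm. 7.1] -/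
theorem hKer_ofRecord :
    ∀ (L : Type) [Field L] [NumberField L] [IsCMField L]
      {v : HeightOneSpectrum (𝓞 ↥(maximalRealSubfield L))} (w : UnitaryGroup.PlacesOver L v)
      (hw : IsCMField.complexConj L • w.1 = w.1) (_he : v.asIdeal.ramificationIdx' w.1.asIdeal ≠ 1)
      (_h2 : ¬ IsUnit (2 : 𝒪[w.1.adicCompletion L]))
      (ϖ : (w.1.adicCompletion L)) (_hϖ : Valued.v ϖ = WithZero.exp (-1 : ℤ)) (d tE : ℕ) (_hD : IsRamifiedQuadraticDatum (galAdicCompletionMap (L := L) (IsCMField.complexConj L) hw) ϖ d tE)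
      [Fintype (Valued.ResidueField (w.1.adicCompletion L))] (δ : (w.1.adicCompletion L)) (_hδ : (galAdicCompletionMap (L := L) (IsCMField.complexConj L) hw) δ = -δ) (_hδ0 : δ ≠ 0)
      (μ : HeckeCharacter L) (_hμu : μ.IsUnitary)
      (_hμω : ∀ x : ideleGroup ↥(maximalRealSubfield L), μ (AdeleRing.ideleBaseChange ↥(maximalRealSubfield L) L x) = quadraticHeckeCharCM L x)
      [MeasurableSpace ((UnitaryGroup.cmDatum L 3 (Matrix.of fun i j : Fin 3 => if i.val + j.val + 1 = 3 then (1 : L) else 0)).Local v)] [BorelSpace ((UnitaryGroup.cmDatum L 3 (Matrix.of fun i j : Fin 3 => if i.val + j.val + 1 = 3 then (1 : L) else 0)).Local v)]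
      [∀ γ : ((UnitaryGroup.cmDatum L 3 (Matrix.of fun i j : Fin 3 => if i.val + j.val + 1 = 3 then (1 : L) else 0)).Local v), MeasurableSpace (((UnitaryGroup.cmDatum L 3 (Matrix.of fun i j : Fin 3 => if i.val + j.val + 1 = 3 then (1 : L) else 0)).Local v) ⧸ Subgroup.centralizer ({γ} : Set ((UnitaryGroup.cmDatum L 3 (Matrix.of fun i j : Fin 3 => if i.val + j.val + 1 = 3 then (1 : L) else 0)).Local v)))]
      [∀ γ : ((UnitaryGroup.cmDatum L 3 (Matrix.of fun i j : Fin 3 => if i.val + j.val + 1 = 3 then (1 : L) else 0)).Local v), BorelSpace (((UnitaryGroup.cmDatum L 3 (Matrix.of fun i j : Fin 3 => if i.val + j.val + 1 = 3 then (1 : L) else 0)).Local v) ⧸ Subgroup.centralizer ({γ} : Set ((UnitaryGroup.cmDatum L 3 (Matrix.of fun i j : Fin 3 => if i.val + j.val + 1 = 3 then (1 : L) else 0)).Local v)))]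
      [MeasurableSpace ((UnitaryGroup.cmDatum L 2 (Matrix.of fun i j : Fin 2 => if i.val + j.val + 1 = 2 then (1 : L) else 0)).Local v × (UnitaryGroup.cmDatum L 1 (Matrix.of fun i j : Fin 1 => if i.val + j.val + 1 = 1 then (1 : L) else 0)).Local v)] [BorelSpace ((UnitaryGroup.cmDatum L 2 (Matrix.of fun i j : Fin 2 => if i.val + j.val + 1 = 2 then (1 : L) else 0)).Local v × (UnitaryGroup.cmDatum L 1 (Matrix.of fun i j : Fin 1 => if i.val + j.val + 1 = 1 then (1 : L) else 0)).Local v)]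
      [∀ a : ((UnitaryGroup.cmDatum L 2 (Matrix.of fun i j : Fin 2 => if i.val + j.val + 1 = 2 then (1 : L) else 0)).Local v × (UnitaryGroup.cmDatum L 1 (Matrix.of fun i j : Fin 1 => if i.val + j.val + 1 = 1 then (1 : L) else 0)).Local v), MeasurableSpace (((UnitaryGroup.cmDatum L 2 (Matrix.of fun i j : Fin 2 => if i.val + j.val + 1 = 2 then (1 : L) else 0)).Local v × (UnitaryGroup.cmDatum L 1 (Matrix.of fun i j : Fin 1 => if i.val + j.val + 1 = 1 then (1 : L) else 0)).Local v) ⧸ Subgroup.centralizer ({a} : Set ((UnitaryGroup.cmDatum L 2 (Matrix.of fun i j : Fin 2 => if i.val + j.val + 1 = 2 then (1 : L) else 0)).Local v × (UnitaryGroup.cmDatum L 1 (Matrix.of fun i j : Fin 1 => if i.val + j.val + 1 = 1 then (1 : L) else 0)).Local v)))]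
      [∀ a : ((UnitaryGroup.cmDatum L 2 (Matrix.of fun i j : Fin 2 => if i.val + j.val + 1 = 2 then (1 : L) else 0)).Local v × (UnitaryGroup.cmDatum L 1 (Matrix.of fun i j : Fin 1 => if i.val + j.val + 1 = 1 then (1 : L) else 0)).Local v), BorelSpace (((UnitaryGroup.cmDatum L 2 (Matrix.of fun i j : Fin 2 => if i.val + j.val + 1 = 2 then (1 : L) else 0)).Local v × (UnitaryGroup.cmDatum L 1 (Matrix.of fun i j : Fin 1 => if i.val + j.val + 1 = 1 then (1 : L) else 0)).Local v) ⧸ Subgroup.centralizer ({a} : Set ((UnitaryGroup.cmDatum L 2 (Matrix.of fun i j : Fin 2 => if i.val + j.val + 1 = 2 then (1 : L) else 0)).Local v × (UnitaryGroup.cmDatum L 1 (Matrix.of fun i j : Fin 1 => if i.val + j.val + 1 = 1 then (1 : L) else 0)).Local v)))]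
      (νH : Measure ((UnitaryGroup.cmDatum L 2 (Matrix.of fun i j : Fin 2 => if i.val + j.val + 1 = 2 then (1 : L) else 0)).Local v × (UnitaryGroup.cmDatum L 1 (Matrix.of fun i j : Fin 1 => if i.val + j.val + 1 = 1 then (1 : L) else 0)).Local v)) [νH.IsHaarMeasure] [νH.IsMulRightInvariant]
      (νG₃ : Measure ((UnitaryGroup.cmDatum L 3 (Matrix.of fun i j : Fin 3 => if i.val + j.val + 1 = 3 then (1 : L) else 0)).Local v)) [νG₃.IsHaarMeasure] [νG₃.IsMulRightInvariant]
      (mH : OrbitalMeasureFamily ((UnitaryGroup.cmDatum L 2 (Matrix.of fun i j : Fin 2 => if i.val + j.val + 1 = 2 then (1 : L) else 0)).Local v × (UnitaryGroup.cmDatum L 1 (Matrix.of fun i j : Fin 1 => if i.val + j.val + 1 = 1 then (1 : L) else 0)).Local v)) (mG₃ : OrbitalMeasureFamily ((UnitaryGroup.cmDatum L 3 (Matrix.of fun i j : Fin 3 => if i.val + j.val + 1 = 3 then (1 : L) else 0)).Local v))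
      (_hmH : mH.IsCanonical (IsLocalGRegular L v) νH) (_hmG : mG₃.IsCanonical (fun γ => IsRegularElt (γ.val : GL (Fin 3) (UnitaryGroup.LocalRing L v))) νG₃),
                                  (∃ V ∈ 𝓝 (1 : ((UnitaryGroup.cmDatum L 2 (Matrix.of fun i j : Fin 2 => if i.val + j.val + 1 = 2 then (1 : L) else 0)).Local v × (UnitaryGroup.cmDatum L 1 (Matrix.of fun i j : Fin 1 => if i.val + j.val + 1 = 1 then (1 : L) else 0)).Local v)), ∀ γH ∈ V, IsLocalGRegular L v γH →
    ¬ (∃ x : (w.1.adicCompletion L), (((((γH).1.val : GL (Fin 2) (UnitaryGroup.LocalRing L v)).val.map (Pi.evalRingHom (fun w' : UnitaryGroup.PlacesOver L v => w'.1.adicCompletion L) w))).charpoly).IsRoot x) →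
    ∀ δ : ((UnitaryGroup.cmDatum L 3 (Matrix.of fun i j : Fin 3 => if i.val + j.val + 1 = 3 then (1 : L) else 0)).Local v), IsLocalNormPair L (Matrix.of fun i j : Fin 3 => if i.val + j.val + 1 = 3 then (1 : L) else 0) v γH δ →
      ∃ (π : (Fin 3 → (w.1.adicCompletion L)) →ₗ[w.1.adicCompletion L] (w.1.adicCompletion L)) (s p : (w.1.adicCompletion L)),
        (∀ m : Fin 3 → (w.1.adicCompletion L), π m = 0 →
          ((((localNonsplitEquiv (IsCMField.complexConj L) (Matrix.of fun i j : Fin 3 => if i.val + j.val + 1 = 3 then (1 : L) else 0) (IsCMField.complexConj_ne_one L) w hw δ :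
            ↥(unitaryGroupOfForm (galAdicCompletionMap (L := L) (IsCMField.complexConj L) hw) (placeForm (Matrix.of fun i j : Fin 3 => if i.val + j.val + 1 = 3 then (1 : L) else 0) w.1))) : GL (Fin 3) (w.1.adicCompletion L)) : Matrix (Fin 3) (Fin 3) (w.1.adicCompletion L)) - 1) *ᵥ (((((localNonsplitEquiv (IsCMField.complexConj L) (Matrix.of fun i j : Fin 3 => if i.val + j.val + 1 = 3 then (1 : L) else 0) (IsCMField.complexConj_ne_one L) w hw δ :
            ↥(unitaryGroupOfForm (galAdicCompletionMap (L := L) (IsCMField.complexConj L) hw) (placeForm (Matrix.of fun i j : Fin 3 => if i.val + j.val + 1 = 3 then (1 : L) else 0) w.1))) : GL (Fin 3) (w.1.adicCompletion L)) : Matrix (Fin 3) (Fin 3) (w.1.adicCompletion L)) - 1) *ᵥ m) =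
            s • (((((localNonsplitEquiv (IsCMField.complexConj L) (Matrix.of fun i j : Fin 3 => if i.val + j.val + 1 = 3 then (1 : L) else 0) (IsCMField.complexConj_ne_one L) w hw δ :
            ↥(unitaryGroupOfForm (galAdicCompletionMap (L := L) (IsCMField.complexConj L) hw) (placeForm (Matrix.of fun i j : Fin 3 => if i.val + j.val + 1 = 3 then (1 : L) else 0) w.1))) : GL (Fin 3) (w.1.adicCompletion L)) : Matrix (Fin 3) (Fin 3) (w.1.adicCompletion L)) - 1) *ᵥ m) - p • m) ∧
        Valued.v s * Valued.v (ϖ ^ (d % 2)) ≤ Valued.v (ϖ ^ mcOfRecord d) ∧ Valued.v p ≤ Valued.v (ϖ ^ mcOfRecord d)) := by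
  intro L _ _ _ v w hw he _h2 ϖ hϖ d tE hD _ δ₀ _hδ₀ _hδ₀0 μ _hμu _hμω _ _ _ _ _ _ _ _ νH _ _ νG₃ _ _ mH mG₃ _hmH _hmG
  classical
  have hϖ0 : ϖ ≠ 0 := (uniformizer_facts L w hϖ).1
  have hϖ1 : Valued.v ϖ ≤ 1 := (uniformizer_facts L w hϖ).2.1.le
  have hc0 : ϖ ^ mcOfRecord d ≠ 0 := pow_ne_zero _ hϖ0
  have hc1 : Valued.v (ϖ ^ mcOfRecord d) ≤ 1 := by rw [map_pow]; exact pow_le_one₀ zero_le hϖ1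
  obtain ⟨Vc, hVc, hcongr⟩ := F0P3cDyRamTypeTwoBlockCongruenceNhds.exists_nhds_one_block_congr L v w hc0
  obtain ⟨VA, hVA, hA⟩ := F0P3cDyRamTypeTwoOppositeLiteralWild.exists_oppositeLiteral_wild L w hw he hD
  refine ⟨Vc ∩ VA, Filter.inter_mem hVc hVA, fun γH hγ hreg hirr δ hδ => ?_⟩
  obtain ⟨hγc, hγA⟩ := hγ
  -- the w-block `g_w`, its two Cayley–Hamilton coefficients, and their bounds (§2)
  obtain ⟨hblock, -⟩ := hcongr γH hγc
  have hs : Valued.v ((((γH).1.val : GL (Fin 2) (UnitaryGroup.LocalRing L v)).val.map (Pi.evalRingHom (fun w' : UnitaryGroup.PlacesOver L v => w'.1.adicCompletion L) w)).trace - 2) ≤ Valued.v (ϖ ^ mcOfRecord d) := F0P3cDyRamTypeTwoTubeLetters.v_trace_sub_two_le hblock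
  have hp : Valued.v ((((γH).1.val : GL (Fin 2) (UnitaryGroup.LocalRing L v)).val.map (Pi.evalRingHom (fun w' : UnitaryGroup.PlacesOver L v => w'.1.adicCompletion L) w)).det - (((γH).1.val : GL (Fin 2) (UnitaryGroup.LocalRing L v)).val.map (Pi.evalRingHom (fun w' : UnitaryGroup.PlacesOver L v => w'.1.adicCompletion L) w)).trace + 1) ≤ Valued.v (ϖ ^ mcOfRecord d) := v_det_sub_trace_add_one_le hc1 hblock
  -- `ι_w` as a homomorphism
  let ι : ((UnitaryGroup.cmDatum L 3 (Matrix.of fun i j : Fin 3 => if i.val + j.val + 1 = 3 then (1 : L) else 0)).Local v) →* GL (Fin 3) (w.1.adicCompletion L) :=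
    (Subgroup.subtype _).comp (localNonsplitEquiv (IsCMField.complexConj L) (Matrix.of fun i j : Fin 3 => if i.val + j.val + 1 = 3 then (1 : L) else 0) (IsCMField.complexConj_ne_one L) w hw).toMulEquiv.toMonoidHom
  have hιe : ∀ x, ι x = ((localNonsplitEquiv (IsCMField.complexConj L) (Matrix.of fun i j : Fin 3 => if i.val + j.val + 1 = 3 then (1 : L) else 0) (IsCMField.complexConj_ne_one L) w hw x :
        ↥(unitaryGroupOfForm (galAdicCompletionMap (L := L) (IsCMField.complexConj L) hw) (placeForm (Matrix.of fun i j : Fin 3 => if i.val + j.val + 1 = 3 then (1 : L) else 0) w.1))) : GL (Fin 3) (w.1.adicCompletion L)) := fun _ => rfl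
  -- the signed pair and its exhaustion (★ p847309 road), the two literal shapes
  have hH : ((Matrix.of fun i j : Fin 3 => if i.val + j.val + 1 = 3 then (1 : L) else 0).map (cmConjRingHom L))ᵀ = (Matrix.of fun i j : Fin 3 => if i.val + j.val + 1 = 3 then (1 : L) else 0) := antidiagOne_isHermitian L 3
  have hdet : (Matrix.of fun i j : Fin 3 => if i.val + j.val + 1 = 3 then (1 : L) else 0).det ≠ 0 := (isUnit_antidiagOne_det L 3).ne_zero
  obtain ⟨b₀, hb₀⟩ := exists_isLocalNormPair_of_formCongr L (Matrix.of fun i j : Fin 3 => if i.val + j.val + 1 = 3 then (1 : L) else 0) w hw (1 : GL (Fin 3) (w.1.adicCompletion L)) (c := (1 : (w.1.adicCompletion L))) isUnit_one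
    (by rw [one_smul, placeForm_antidiagThree_eq_over L w, formCongr_one_eq]) γH
  obtain ⟨δp, δm, hpn, hκp, hmn, hκm, hexp, hexm, -⟩ :=
    exists_signedPair_finsum_delta_mul_classOrbitalIntegral_eq_mul_sub L (Matrix.of fun i j : Fin 3 => if i.val + j.val + 1 = 3 then (1 : L) else 0) hH hdet w hw μ
      (finExplicitDelta_conj_left_all L (Matrix.of fun i j : Fin 3 => if i.val + j.val + 1 = 3 then (1 : L) else 0) μ) (finExplicitDelta_conj_right_all L (Matrix.of fun i j : Fin 3 => if i.val + j.val + 1 = 3 then (1 : L) else 0) μ) hirr hb₀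
  have hu : IsUnit ((finCharpolyTwo L v γH).eval (finGammaTwo L v γH)) := isUnit_eval_finCharpolyTwo_of_isLocalGRegular L v γH hreg
  -- the hyperbolic literal `t_h` (frame `A := 1`)
  have hH'w : IsUnit (placeForm (Matrix.of fun i j : Fin 3 => if i.val + j.val + 1 = 3 then (1 : L) else 0) w.1) := isUnit_placeForm_antidiagOne (E := L) 3 w.1
  have hdet' : (placeForm (Matrix.of fun i j : Fin 3 => if i.val + j.val + 1 = 3 then (1 : L) else 0) w.1).det = -1 := by
    rw [placeForm_antidiagOne, F0P3cDyRamFixedPointCensusTypeTwoPrelude.antidiagonal_three_over_eq_block_antidiagonal_two, Matrix.det_fin_three]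
    simp [StdForm.over, StdForm.antidiagonal_J_apply, Fin.rev]
  have hframe : placeForm (Matrix.of fun i j : Fin 3 => if i.val + j.val + 1 = 3 then (1 : L) else 0) w.1 = (-(placeForm (Matrix.of fun i j : Fin 3 => if i.val + j.val + 1 = 3 then (1 : L) else 0) w.1).det) •
      formCongr (galAdicCompletionMap (L := L) (IsCMField.complexConj L) hw) (1 : GL (Fin 3) (w.1.adicCompletion L)) ((StdForm.antidiagonal 3).over (w.1.adicCompletion L)) := by
    rw [formCongr_one_eq, hdet', neg_neg, one_smul, placeForm_antidiagOne]
  have hyl : toPlace v w (1 : (v.adicCompletion ↥(maximalRealSubfield L))) = -(placeForm (Matrix.of fun i j : Fin 3 => if i.val + j.val + 1 = 3 then (1 : L) else 0) w.1).det := by rw [map_one, hdet', neg_neg]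
  obtain ⟨th, hth, hmat⟩ := exists_isLocalNormPair_coe_eq_of_frame L (Matrix.of fun i j : Fin 3 => if i.val + j.val + 1 = 3 then (1 : L) else 0) w hw hH'w 1 hframe γH
  have hκh : finKappaAt L v (Matrix.of fun i j : Fin 3 => if i.val + j.val + 1 = 3 then (1 : L) else 0) γH th = 1 := by
    rw [finKappaAt_eq_hilbertSymbol_of_coe_eq_of_frame L (Matrix.of fun i j : Fin 3 => if i.val + j.val + 1 = 3 then (1 : L) else 0) w hw hH'w 1 hframe 1 hyl γH hu hth hmat, hilbertSymbol_one_left]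
  rw [inv_one, one_mul, mul_one] at hmat
  -- the anisotropic literal `t_a` (★ p857702)
  obtain ⟨ta, P₁, dg, η, γ₁, hta, hκa, hA1, -, -, -, -, -, -, -, hA10⟩ := hA γH hγA hreg hirr
  -- `δ` is `G_v`-conjugate to one of them: `ι_w δ = Q·ι(A, u_w)·Q⁻¹` with `χ_A = χ_{g_w}`
  have key : ∃ (Q : GL (Fin 3) (w.1.adicCompletion L)) (A : GL (Fin 2) (w.1.adicCompletion L)) (u' : GL (Fin 1) (w.1.adicCompletion L)),
      (((localNonsplitEquiv (IsCMField.complexConj L) (Matrix.of fun i j : Fin 3 => if i.val + j.val + 1 = 3 then (1 : L) else 0) (IsCMField.complexConj_ne_one L) w hw δ :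
        ↥(unitaryGroupOfForm (galAdicCompletionMap (L := L) (IsCMField.complexConj L) hw) (placeForm (Matrix.of fun i j : Fin 3 => if i.val + j.val + 1 = 3 then (1 : L) else 0) w.1))) : GL (Fin 3) (w.1.adicCompletion L)) : Matrix (Fin 3) (Fin 3) (w.1.adicCompletion L)) =
        (Q : Matrix (Fin 3) (Fin 3) (w.1.adicCompletion L)) * ((endoGL (A, u') : GL (Fin 3) (w.1.adicCompletion L)) : Matrix (Fin 3) (Fin 3) (w.1.adicCompletion L)) * ((Q⁻¹ : GL (Fin 3) (w.1.adicCompletion L)) : Matrix (Fin 3) (Fin 3) (w.1.adicCompletion L)) ∧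
      (A : Matrix (Fin 2) (Fin 2) (w.1.adicCompletion L)).charpoly = (((γH).1.val : GL (Fin 2) (UnitaryGroup.LocalRing L v)).val.map (Pi.evalRingHom (fun w' : UnitaryGroup.PlacesOver L v => w'.1.adicCompletion L) w)).charpoly := by
    rcases finKappaAt_eq_one_or_eq_neg_one_of_isUnit L v (Matrix.of fun i j : Fin 3 => if i.val + j.val + 1 = 3 then (1 : L) else 0) γH δ hδ hu with h1 | h1
    · -- conjugate to `t_h`
      obtain ⟨c, hc⟩ := isConj_iff.1 ((hexp th hth hκh).symm.trans (hexp δ hδ h1))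
      have hδe : ι δ = ι c * ι th * (ι c)⁻¹ := by rw [← hc, map_mul, map_mul, map_inv]
      refine ⟨ι c, ((localNonsplitEquiv (IsCMField.complexConj L) (Matrix.of fun i j : Fin 2 => if i.val + j.val + 1 = 2 then (1 : L) else 0) (IsCMField.complexConj_ne_one L) w hw γH.1 :
          ↥(unitaryGroupOfForm (galAdicCompletionMap (L := L) (IsCMField.complexConj L) hw) (placeForm (Matrix.of fun i j : Fin 2 => if i.val + j.val + 1 = 2 then (1 : L) else 0) w.1))) : GL (Fin 2) (w.1.adicCompletion L)),
        ((localNonsplitEquiv (IsCMField.complexConj L) (Matrix.of fun i j : Fin 1 => if i.val + j.val + 1 = 1 then (1 : L) else 0) (IsCMField.complexConj_ne_one L) w hw γH.2 :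
          ↥(unitaryGroupOfForm (galAdicCompletionMap (L := L) (IsCMField.complexConj L) hw) (placeForm (Matrix.of fun i j : Fin 1 => if i.val + j.val + 1 = 1 then (1 : L) else 0) w.1))) : GL (Fin 1) (w.1.adicCompletion L)), ?_, rfl⟩
      rw [← hιe δ, hδe, Units.val_mul, Units.val_mul, Matrix.coe_units_inv, hιe th, hmat]
    · -- conjugate to `t_a`
      obtain ⟨c, hc⟩ := isConj_iff.1 ((hexm ta hta hκa).symm.trans (hexm δ hδ h1))
      have hδe : ι δ = ι c * ι ta * (ι c)⁻¹ := by rw [← hc, map_mul, map_mul, map_inv]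
      refine ⟨ι c * P₁, γ₁, ((localNonsplitEquiv (IsCMField.complexConj L) (Matrix.of fun i j : Fin 1 => if i.val + j.val + 1 = 1 then (1 : L) else 0) (IsCMField.complexConj_ne_one L) w hw γH.2 :
          ↥(unitaryGroupOfForm (galAdicCompletionMap (L := L) (IsCMField.complexConj L) hw) (placeForm (Matrix.of fun i j : Fin 1 => if i.val + j.val + 1 = 1 then (1 : L) else 0) w.1))) : GL (Fin 1) (w.1.adicCompletion L)), ?_, hA10⟩
      have hGL : ι δ = (ι c * P₁) * endoGL (γ₁, ((localNonsplitEquiv (IsCMField.complexConj L) (Matrix.of fun i j : Fin 1 => if i.val + j.val + 1 = 1 then (1 : L) else 0) (IsCMField.complexConj_ne_one L) w hw γH.2 :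
          ↥(unitaryGroupOfForm (galAdicCompletionMap (L := L) (IsCMField.complexConj L) hw) (placeForm (Matrix.of fun i j : Fin 1 => if i.val + j.val + 1 = 1 then (1 : L) else 0) w.1))) : GL (Fin 1) (w.1.adicCompletion L))) * (ι c * P₁)⁻¹ := by
        rw [hδe, hιe ta, hA1, mul_inv_rev]
        simp only [mul_assoc]
      rw [← hιe δ, hGL, Units.val_mul, Units.val_mul]
  obtain ⟨Q, A, u', hT, hχ⟩ := key
  -- the functional cutting out `δ`'s plane and the Cayley–Hamilton identity on its kernel (§1)
  refine ⟨(LinearMap.proj (1 : Fin 3) : (Fin 3 → (w.1.adicCompletion L)) →ₗ[(w.1.adicCompletion L)] (w.1.adicCompletion L)).comp (Matrix.toLin' ((Q⁻¹ : GL (Fin 3) (w.1.adicCompletion L)) : Matrix (Fin 3) (Fin 3) (w.1.adicCompletion L))),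
    (((γH).1.val : GL (Fin 2) (UnitaryGroup.LocalRing L v)).val.map (Pi.evalRingHom (fun w' : UnitaryGroup.PlacesOver L v => w'.1.adicCompletion L) w)).trace - 2, (((γH).1.val : GL (Fin 2) (UnitaryGroup.LocalRing L v)).val.map (Pi.evalRingHom (fun w' : UnitaryGroup.PlacesOver L v => w'.1.adicCompletion L) w)).det - (((γH).1.val : GL (Fin 2) (UnitaryGroup.LocalRing L v)).val.map (Pi.evalRingHom (fun w' : UnitaryGroup.PlacesOver L v => w'.1.adicCompletion L) w)).trace + 1, fun m hm => ?_, ?_, hp⟩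
  · have hm' : (((Q⁻¹ : GL (Fin 3) (w.1.adicCompletion L)) : Matrix (Fin 3) (Fin 3) (w.1.adicCompletion L)) *ᵥ m) 1 = 0 := by
      simpa [LinearMap.comp_apply, Matrix.toLin'_apply] using hm
    rw [kerCH_of_eq_conj_endoGL Q A u' hT m hm', Literature.NumberTheory.Rogawski1990.SpectralTie.trace_eq_of_charpoly_eq hχ,
      Literature.NumberTheory.Rogawski1990.SpectralTie.det_eq_of_charpoly_eq hχ]
  · calc Valued.v ((((γH).1.val : GL (Fin 2) (UnitaryGroup.LocalRing L v)).val.map (Pi.evalRingHom (fun w' : UnitaryGroup.PlacesOver L v => w'.1.adicCompletion L) w)).trace - 2) * Valued.v (ϖ ^ (d % 2))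
        ≤ Valued.v (ϖ ^ mcOfRecord d) * 1 := mul_le_mul' hs (by rw [map_pow]; exact pow_le_one₀ zero_le hϖ1)
      _ = Valued.v (ϖ ^ mcOfRecord d) := mul_one _

end Summit.HodgeConjecture.HodgeConjecture.Cruxes.H413.F0P3cDyRamKernelCHOfTypeTwo

end
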